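import Literature.LinearAlgebra.RootSystem.ParabolicShapes
import Literature.LinearAlgebra.RootSystem.HighestRootIsLong
import HarnessLib

/-!
# The short grading `Δ = Δ₋₁ ∪ Δ₀ ∪ Δ₁` of an irreducible root system at a simple root `β` of coefficient `1` in the highest root
# (parabolic subgroups with abelian unipotent radical): `Δ₁` is «abelian», pairs non-negatively, its long roots form one `W₀`-orbit,
# and `β` is long (Tevelev, *Projectively dual varieties*, §3, Propositions 2.14, 2.15 (a); Richardson–Röhrle–Steinberg, Lemma 2.3)

E. Tevelev, *Projectively Dual Varieties* (survey, arXiv:math/0112028 (2001) = J. Math. Sci. 117 (2003); held `paper:arxiv-math_0112028`,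
chunk p0025), §3 "Parabolic Subgroups With Abelian Unipotent Radical": "Let `L` be a simple algebraic group and `P ⊂ L` a parabolic subgroup
with abelian unipotent radical. In this case `𝔩` admits a `ℤ`-grading with only three non-zero parts: `𝔩 = 𝔩₋₁ ⊕ 𝔩₀ ⊕ 𝔩₁`. Such a grading
is said to be short. … `Δ = Δ₋₁ ∪ Δ₀ ∪ Δ₁` is the partition corresponding to the short grading. We fix a Borel subgroup `B ⊂ G` containing
`T`. This choice determines a set of positive roots `Δ₀⁺ ⊂ Δ₀` and `Δ⁺ = Δ₀⁺ ∪ Δ₁ ⊂ Δ`. We denote by `γ` the highest root in `Δ⁺`, in fact in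
`Δ₁`. `Π` is the set of simple roots in `Δ⁺`, then `Π₀ = Π ∩ Δ₀` is the set of simple roots in `Δ₀⁺`. Let `W` (resp. `W₀`) be the Weil
group of `𝔩` (resp. of `𝔤`) … Therefore … `P` is a maximal parabolic subgroup, and `#Π₀ = #Π - 1`. Thus, there is a unique simple root in
`Δ₁`. Call it `β`. **Proposition 2.14.** (a) `β` is long. (b) The `β`-height of any root `α₀ ∈ Δ₁`, i.e. the coefficient `n_β` in the sum
`α₀ = n_β β + Σ_{α ∈ Π₀} n_α α`, is equal to `1`. (c) For any `α, α' ∈ Δ₁`, `(α, α') ≥ 0`. (d) `W₀` acts transitively on long roots in `Δ₁`.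
… (c) Suppose that `α, α' ∈ Δ₁`. Since `[e_α, e_{α'}] = 0`, it follows that `α + α'` is not a root, therefore, `(α, α') ≥ 0`. (d) Suppose
that `α₀ ∈ Δ₁` is a long root … If we have `(α₀, α) < 0` for some `α ∈ Π₀` then `w_α(α₀) > α₀` and we may finish by induction. Suppose that
`(α₀, α) ≥ 0` for all `α ∈ Π₀`. Since `(α₀, β) ≥ 0` by (c), `α₀` is a dominant weight for `𝔩`. Since `α₀` is long, it follows that
`α₀ = δ`. Therefore, all long roots in `Δ₁` are `W₀`-conjugate to `δ`. On the contrary, if `𝔩` is an arbitrary simple Lie algebra,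
`Δ ⊃ Π` is the root system and the simple roots, `β ∈ Π`, and the `β`-height of the highest root is equal to `1`, then, clearly, the maximal
parabolic subgroup corresponding to `β` has an abelian unipotent radical. … Let `Δ' = {α ∈ Δ | (α, β) = 0}`. … **Proposition 2.15.**
Suppose that `Δ'₁ ≠ ∅`. Then (a) `δ ∈ Δ'₁`. … Indeed, suppose that `(β, α₀) = 0` for some `α₀ ∈ Δ₁`. Then
`(β, δ) = (β, α₀) + (β, Σ_{α ∈ Π₀} n_α α)`, where all `n_α ≥ 0`. Since `(β, α) ≤ 0` for any `α ∈ Π₀`, we get `(β, δ) ≤ 0`. Since `(β, δ) ≥ 0`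
…, we see that `δ ∈ Δ'₁`." (`δ = γ` is the highest root.)
R. Richardson, G. Röhrle, R. Steinberg, *Parabolic subgroups with abelian unipotent radical*, Invent. Math. 110 (1992) — cite-only (acq-14486);
as restated in the held secondary `paper:doi-10-1006-jcta-2001-3210` (J. Combin. Theory A, 2002), p. 5: "By [RRS, Lemma 2.3] `P_J` has an abelian
unipotent radical if and only if `P_J` is maximal and the corresponding simple root `α` (`J = Δ - {α}`) occurs in the highest root with
coefficient `1`."

THIS FILE (lane `lit-hodgefound`, prover seat p40, generation 40, row g40-#2; topic `Literature/LinearAlgebra/RootSystem`, namespace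
`Literature.LinearAlgebra.RootSystem.Base`) proves the ROOT-SYSTEM content of these statements for a finite reduced crystallographic root pairing
`P : RootPairing ι K M N` over a field `K` of characteristic `0` (no order on `K`) with base `b` (`Δ = Π = b.support`), on top of the SHAPES of
g40-#1 (`ParabolicShapes`): for a simple root `β = α_i`, `Π₀ = Δ ∖ {α_i}` is the set `↑b.support ∖ {i}`, `V = span K (Φ(Π₀))`,
`Δ₀ = Φ ∩ V`, `W₀ = W_{Π₀} = Subgroup.closure (s(Π₀))`; the `β`-HEIGHT (the coefficient of `α_i`) is handled shape-style, without a coefficient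
function: «`α_k ∈ Δ₁`» (β-height `1`) is `α_k - α_i ∈ V`, «`α_k ∈ Δ₀`» is `α_k ∈ V`, «`α_k ∈ Δ₋₁`» is `α_k + α_i ∈ V` (dictionary with integer
coefficients: `root_sub_root_mem_span_sdiff_iff` & co.); the standing hypothesis «the `β`-height of the highest root `θ` is `1`» is
`hθi : α_θ - α_i ∈ V` (equivalently g38-#9's `θ - α_i ∈ ℕ(Δ ∖ {α_i})`, `root_sub_root_mem_span_sdiff_iff_mem_closure`), with `θ` the highest root
in the tree's sense (`θ - α ∈ ℕΔ` for all roots `α`, g36-#7 `HighestRoot`). The Lie algebra `𝔩`, its grading and the group `P` are not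
introduced; "abelian unipotent radical" is rendered by its root-theoretic meaning «the sum of two roots of `Φ⁺ ∖ Δ₀` is never a root».

## What is proved (THEOREMS ONLY: no definition, no instance, no notation, no named fact; net debt 0)

* §1 THE THREE LEVELS: **`intCoeff_le_of_highestRoot`** (every coefficient of a root is bounded by that of `θ`), ★
  **`root_sub_root_mem_span_sdiff_iff`** ∕ **`root_mem_span_sdiff_iff`** ∕ **`root_add_root_mem_span_sdiff_iff`** (the three levels as
  `α_i`-coefficient `1 ∕ 0 ∕ -1`), **`root_sub_root_mem_span_sdiff_iff_mem_closure`** (bridge to g38-#9's spelling of «`m_i(θ) = 1`»), ★★★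
  **`root_sub_mem_or_mem_or_add_mem_of_highestRoot`** (PROP. 2.14 (b), root form: if the `β`-height of `θ` is `1`, EVERY root has `β`-height
  `1`, `0` or `-1` — the partition `Δ = Δ₁ ∪ Δ₀ ∪ Δ₋₁`), the exclusions **`root_notMem_span_sdiff_of_root_sub_root_mem`** ∕
  **`root_add_root_notMem_span_sdiff_of_root_sub_root_mem`** ∕ **`root_notMem_span_sdiff_of_root_add_root_mem`**, ★ **`isPos_of_root_sub_root_mem_span_sdiff`**
  ∕ **`not_isPos_of_root_add_root_mem_span_sdiff`** (`Δ₁ ⊆ Δ⁺`, `Δ₋₁ ⊆ Δ⁻`), ★★ **`root_sub_root_mem_span_sdiff_of_isPos_of_notMem`**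
  («`Δ⁺ = Δ₀⁺ ∪ Δ₁`»: a positive root outside `Δ₀` lies in `Δ₁`), ★ **`eq_of_mem_support_of_root_sub_root_mem_span_sdiff`** («there is a
  unique simple root in `Δ₁`»), ★ **`height_le_of_root_sub_root_mem_span_sdiff`** ∕ ★★ **`eq_of_root_sub_root_mem_span_sdiff_of_height_le`**
  (`β` is the unique lowest root of `Δ₁`; «`γ` the highest root … in fact in `Δ₁`» is `hθi` itself).
* §2 ABELIAN RADICAL ⟺ COEFFICIENT `1` (RRS LEMMA 2.3 for maximal parabolics, root form): ★★★ **`root_add_root_notMem_range_of_highestRoot`**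
  (`β`-height of `θ` is `1` ⟹ `α + α' ∉ Φ` for `α, α' ∈ Δ₁`: «`[e_α, e_{α'}] = 0`»), ★★ **`root_add_root_notMem_range_of_isPos_of_notMem`**
  (the same for positive roots outside `Δ₀` — the radical is abelian; Tevelev's «On the contrary … clearly»), ★★★
  **`root_sub_root_mem_span_sdiff_of_forall_add_notMem`** (CONVERSELY: if no two positive roots outside `Δ₀` add up to a root then the
  `β`-height of `θ` is `1` — by Mathlib's generation of positive roots by adding simple roots, `IsPos.induction_on_add`: the `α_i`-coefficient
  of a positive root never exceeds `1`), ★★★ **`root_sub_root_mem_span_sdiff_iff_forall_add_notMem`** (THE EQUIVALENCE).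
* §3 PROP. 2.14 (c): ★★★ **`pairingIn_nonneg_of_root_sub_root_mem_span_sdiff`** (`⟨α, α'^∨⟩ ≥ 0` for `α, α' ∈ Δ₁` — else `α + α'` would be a
  root, Mathlib `root_add_root_mem_of_pairingIn_neg`).
* §4 PROP. 2.14 (d) (with Malle–Testerman A.31 (a), g40-#1): ★★★ **`exists_mem_closure_image_smul_eq_of_root_sub_root_mem_span_sdiff`** (two roots
  of `Δ₁` of the same length are `W₀`-conjugate), ★★★ **`exists_mem_closure_image_smul_eq_highestRoot`** («all long roots in `Δ₁` are
  `W₀`-conjugate to `δ`»).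
* §5 PROP. 2.14 (a): ★★ **`intCast_corootCoeff_mul_rootForm_eq`** (for any root `α = Σ f_j α_j` with `α^∨ = Σ c_j α_j^∨`:
  `c_j · (α|α) = f_j · (α_j|α_j)` for the canonical `RootForm`, via Mathlib `(α|α) α^∨ = 2·Polarization(α)`), ★★★
  **`rootForm_root_eq_rootForm_highestRoot_of_root_sub_root_mem_span_sdiff`** («`β` IS LONG»: `(β|β) = (θ|θ)` — `c_i (θ|θ) = (β|β)` with
  `c_i ∈ ℤ` against the tree's `(θ|θ) ∈ {1, 2, 3}·(β|β)`, g36 `HighestRootIsLong`), ★★★ **`form_root_eq_form_highestRoot_of_root_sub_root_mem_span_sdiff`**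
  (the same for every invariant form `B`).
* §6 PROP. 2.15 (a): ★★★ **`pairingIn_highestRoot_eq_zero_of_pairingIn_eq_zero`** (if some `α₀ ∈ Δ₁` is orthogonal to `β` then so is the
  highest root: «`(β, δ) = (β, α₀) + Σ n_α (β, α) ≤ 0`» and `(β, δ) ≥ 0`).

BY NAME, nothing restated: g40-#1 `ParabolicShapes` (`root_sub_root_mem_span_sdiff_singleton_iff`, `eq_zero_of_sum_smul_root_mem_span`,
`isPos_of_root_sub_root_mem_span`, `root_notMem_span_of_root_sub_root_mem_span`, `root_ne_neg_root_of_root_sub_root_mem_span`,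
`eq_of_forall_height_le_of_forall_height_le`, `exists_mem_closure_image_smul_eq_of_form_root_eq`), g37 `ParabolicSubgroup` (`root_mem_span_iff_coeff_eq_zero`,
`sum_smul_root_mem_span`, `root_notMem_span_of_notMem`, `root_mem_span_of_mem`, `isPos_of_coeff_pos`), g36-#7 `HighestRoot` (`coeff_unique`,
`pairingIn_eq_sum_of_root_eq_sum`, `isPos_of_highestRoot`, `coeff_pos_of_highestRoot`, `pairingIn_nonneg_of_highestRoot`), g36 `HighestRootIsLong`
(`form_highestRoot_eq_or`), g36 `WeylGroupRootOrbits` (`exists_weylGroup_smul_eq_of_form_root_eq`, `form_root_smul_root_smul`), g39-#5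
`CoweightTwoWeightsCriterion` (`exists_nsmul_eq_of_mem_closure`, `sum_nsmul_root_mem_closure`); Mathlib (`Base.exists_root_eq_sum_int`,
`Base.IsPos.induction_on_add`, `Base.pairingIn_le_zero_of_ne`, `Base.IsPos.neg_iff_not`, `root_add_root_mem_of_pairingIn_neg`,
`rootForm_self_smul_coroot`, `Polarization`, `toInvariantForm`, `Base.flip`).

## Scope caveats

The Lie-theoretic layer (the grading element `ξ`, `𝔩₀ = 𝔤`, irreducibility and faithfulness of `𝔩₁`, Prop. 2.13; Prop. 2.15 (b)(c), the
canonical strings of strongly orthogonal roots, Prop. 2.16 [RRS] and Theorem 2.17) is not addressed; RRS Lemma 2.3 is rendered only for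
MAXIMAL parabolics `Δ ∖ {α_i}` and in root form (no group `P`). Prop. 2.14 (d) is obtained from Malle–Testerman's Lemma A.31 (a) (g40-#1) rather
than by the printed induction. The case lists by Dynkin type are not formalized. Root pairings are finite, reduced and crystallographic over a
field of characteristic `0`; `θ` and lengths need `Φ` irreducible where stated.

## References

* [Tevelev2001] E. Tevelev, *Projectively Dual Varieties*, arXiv:math/0112028 (2001); J. Math. Sci. (N. Y.) 117 (2003) — §3, Propositions
  2.13, 2.14 (a)–(d) with proofs, the remark "On the contrary …", Proposition 2.15 (a) with proof.
* [RichardsonRoehrleSteinberg1992] R. Richardson, G. Röhrle, R. Steinberg, *Parabolic subgroups with abelian unipotent radical*, Invent. Math.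
  110 (1992) 649–671 — Lemma 2.3 (cite-only, acq-14486; locator from the secondary doi:10.1006/jcta.2001.3210, p. 5).
* [MalleTesterman2011] G. Malle, D. Testerman, *Linear Algebraic Groups and Finite Groups of Lie Type*, CUP (2011) — App. A Lemma A.31 (a),
  §17.1 Definition 17.1 (level).
-/

noncomputable section

open Module Set Function Submodule

namespace Literature.LinearAlgebra.RootSystem

namespace Base

variable {ι K M N : Type*} [Field K] [CharZero K] [AddCommGroup M] [Module K M]
  [AddCommGroup N] [Module K N] [Fintype ι]
  {P : RootPairing ι K M N} [P.IsCrystallographic] [P.IsReduced] (b : P.Base)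

/-! ## §0 Bookkeeping for `Π₀ = Δ ∖ {α_i}` -/

section Prelim

omit [CharZero K] [Fintype ι] [P.IsCrystallographic] [P.IsReduced] in
/-- `Π₀ = Δ ∖ {α_i} ⊆ Δ`. [cite: Tevelev2001, §3 ("Π₀ = Π ∩ Δ₀ is the set of simple roots in Δ₀⁺")] -/
theorem sdiff_singleton_subset_support (i : ι) : ((b.support : Set ι) \ {i}) ⊆ ↑b.support := fun _ hx ↦ hx.1

omit [CharZero K] [Fintype ι] [P.IsCrystallographic] [P.IsReduced] in
/-- `α_i ∉ V = span(Π₀)` for `i ∈ Δ` (linear independence of `Δ`). [cite: Tevelev2001, §3 ("there is a unique simple root in Δ₁. Call it β")] -/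
theorem root_notMem_span_sdiff {i : ι} (hi : i ∈ b.support) : P.root i ∉ span K (P.root '' ((b.support : Set ι) \ {i})) :=
  root_notMem_span_of_notMem b (sdiff_singleton_subset_support b i) hi fun h ↦ h.2 rfl

omit [CharZero K] [Fintype ι] [P.IsCrystallographic] [P.IsReduced] in
/-- The coefficients of the simple root `α_i` along `Δ`: `α_i = Σ_j δ_{ij} α_j`. [cite: MalleTesterman2011, §17.1 Definition 17.1 (shape of a simple root)] -/
theorem root_eq_sum_single [DecidableEq ι] {i : ι} (hi : i ∈ b.support) :
    P.root i = ∑ j ∈ b.support, (Pi.single i (1 : ℤ) : ι → ℤ) j • P.root j := by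
  rw [Finset.sum_eq_single_of_mem i hi (fun j _ hji ↦ by rw [Pi.single_eq_of_ne hji, zero_smul]), Pi.single_eq_same, one_smul]

end Prelim

/-! ## §1 The three levels `Δ₁`, `Δ₀`, `Δ₋₁` relative to `β = α_i` -/

section Levels

omit [P.IsCrystallographic] [P.IsReduced] in
/-- **EVERY COEFFICIENT OF A ROOT IS BOUNDED BY THE CORRESPONDING COEFFICIENT OF THE HIGHEST ROOT**: `θ - α_k ∈ ℕΔ`, so if `θ = Σ f_j α_j` and
`α_k = Σ g_j α_j` then `g_j ≤ f_j` on `Δ`. [cite: Tevelev2001, §3 Prop. 2.14 (b) ("the β-height of any root α₀ ∈ Δ₁ … is equal to 1")] -/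
theorem intCoeff_le_of_highestRoot {θ : ι} (hθ : ∀ k, P.root θ - P.root k ∈ AddSubmonoid.closure (P.root '' (b.support : Set ι)))
    {f : ι → ℤ} (hf : P.root θ = ∑ j ∈ b.support, f j • P.root j) {k : ι} {g : ι → ℤ}
    (hg : P.root k = ∑ j ∈ b.support, g j • P.root j) {j : ι} (hj : j ∈ b.support) : g j ≤ f j := by
  obtain ⟨c, hc0, hc⟩ := exists_nsmul_eq_of_mem_closure b (hθ k)
  have hc' : P.root θ - P.root k = ∑ j ∈ b.support, (c j : ℤ) • P.root j := by
    rw [hc, ← Finset.sum_subset (Finset.subset_univ b.support) (fun l _ hl ↦ by rw [hc0 l hl, zero_smul])]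
    exact Finset.sum_congr rfl fun l _ ↦ (natCast_zsmul _ _).symm
  have h1 : ∑ j ∈ b.support, f j • P.root j = ∑ j ∈ b.support, (g j + c j) • P.root j := by
    rw [← hf, show P.root θ = P.root k + (P.root θ - P.root k) by abel, hc', hg, ← Finset.sum_add_distrib]
    exact Finset.sum_congr rfl fun l _ ↦ (add_smul _ _ _).symm
  have h2 := coeff_unique b h1 hj
  omega

omit [Fintype ι] [P.IsCrystallographic] [P.IsReduced] in
/-- ★ **`α_k ∈ Δ₁` ⟺ THE `β`-HEIGHT OF `α_k` IS `1`**: for `i ∈ Δ` and `α_k = Σ g_j α_j`, `α_k - α_i ∈ span(Π₀)` iff `g_i = 1`.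
[cite: Tevelev2001, §3 Prop. 2.14 (b) ("the β-height … the coefficient n_β")] [cite: MalleTesterman2011, §17.1 Definition 17.1 (level)] -/
theorem root_sub_root_mem_span_sdiff_iff {i : ι} (hi : i ∈ b.support) {k : ι} {g : ι → ℤ}
    (hg : P.root k = ∑ j ∈ b.support, g j • P.root j) :
    P.root k - P.root i ∈ span K (P.root '' ((b.support : Set ι) \ {i})) ↔ g i = 1 := by
  classical
  rw [root_sub_root_mem_span_sdiff_singleton_iff b hi hg (root_eq_sum_single b hi), Pi.single_eq_same]

omit [Fintype ι] [P.IsCrystallographic] [P.IsReduced] in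
/-- ★ **`α_k ∈ Δ₀` ⟺ THE `β`-HEIGHT OF `α_k` IS `0`**: `α_k ∈ span(Π₀)` iff `g_i = 0`. [cite: Tevelev2001, §3 ("Δ = Δ₋₁ ∪ Δ₀ ∪ Δ₁ is the partition corresponding to the short grading")] -/
theorem root_mem_span_sdiff_iff {i : ι} (hi : i ∈ b.support) {k : ι} {g : ι → ℤ}
    (hg : P.root k = ∑ j ∈ b.support, g j • P.root j) :
    P.root k ∈ span K (P.root '' ((b.support : Set ι) \ {i})) ↔ g i = 0 := by
  rw [root_mem_span_iff_coeff_eq_zero b (sdiff_singleton_subset_support b i) hg]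
  refine ⟨fun h ↦ h i hi fun h' ↦ h'.2 rfl, fun h j hj hjI ↦ ?_⟩
  have hji : j = i := by
    by_contra hne
    exact hjI ⟨hj, hne⟩
  rw [hji, h]

omit [Fintype ι] [P.IsCrystallographic] [P.IsReduced] in
/-- ★ **`α_k ∈ Δ₋₁` ⟺ THE `β`-HEIGHT OF `α_k` IS `-1`**: `α_k + α_i ∈ span(Π₀)` iff `g_i = -1`. [cite: Tevelev2001, §3 ("Δ = Δ₋₁ ∪ Δ₀ ∪ Δ₁")] -/
theorem root_add_root_mem_span_sdiff_iff {i : ι} (hi : i ∈ b.support) {k : ι} {g : ι → ℤ}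
    (hg : P.root k = ∑ j ∈ b.support, g j • P.root j) :
    P.root k + P.root i ∈ span K (P.root '' ((b.support : Set ι) \ {i})) ↔ g i = -1 := by
  classical
  have h1 : P.root k + P.root i = ∑ j ∈ b.support, ((g j + (Pi.single i (1 : ℤ) : ι → ℤ) j : ℤ) : K) • P.root j := by
    rw [hg, root_eq_sum_single b hi, ← Finset.sum_add_distrib]
    refine Finset.sum_congr rfl fun j _ ↦ ?_
    rw [Int.cast_add, add_smul, Int.cast_smul_eq_zsmul, Int.cast_smul_eq_zsmul]
  rw [h1]
  refine ⟨fun h ↦ ?_, fun h ↦ ?_⟩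
  · have h2 := eq_zero_of_sum_smul_root_mem_span b (sdiff_singleton_subset_support b i) h hi
      fun h' ↦ h'.2 rfl
    rw [Pi.single_eq_same] at h2
    have h3 : g i + 1 = 0 := by exact_mod_cast h2
    omega
  · refine sum_smul_root_mem_span b fun j hj hjI ↦ ?_
    have hji : j = i := by
      by_contra hne
      exact hjI ⟨hj, hne⟩
    rw [hji, Pi.single_eq_same, h]
    push_cast
    ring

omit [P.IsCrystallographic] [P.IsReduced] in
/-- **BRIDGE TO THE TREE'S SPELLING OF «`m_i(θ) = 1`»** (g38-#9 `MinusculeWeightsHighestCoroot`, with the Finset `Δ.erase i`): for the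
highest root `θ` and `i ∈ Δ`, `θ - α_i ∈ span(Π₀)` iff `θ - α_i ∈ ℕΠ₀`. [cite: Tevelev2001, §3 ("the β-height of the highest root is equal to 1")] -/
theorem root_sub_root_mem_span_sdiff_iff_mem_closure [DecidableEq ι] {θ : ι}
    (hθ : ∀ k, P.root θ - P.root k ∈ AddSubmonoid.closure (P.root '' (b.support : Set ι))) {i : ι} (hi : i ∈ b.support) :
    P.root θ - P.root i ∈ span K (P.root '' ((b.support : Set ι) \ {i})) ↔
      P.root θ - P.root i ∈ AddSubmonoid.closure (P.root '' ↑(b.support.erase i)) := by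
  rw [Finset.coe_erase]
  refine ⟨fun h ↦ ?_, fun h ↦ ?_⟩
  · obtain ⟨c, hc0, hc⟩ := exists_nsmul_eq_of_mem_closure b (hθ i)
    -- the coefficient of `α_i` in `θ - α_i` vanishes
    have hc' : P.root θ - P.root i = ∑ j ∈ b.support, ((c j : ℤ) : K) • P.root j := by
      rw [hc, ← Finset.sum_subset (Finset.subset_univ b.support) (fun l _ hl ↦ by rw [hc0 l hl, zero_smul])]
      exact Finset.sum_congr rfl fun l _ ↦ by rw [Int.cast_natCast, Nat.cast_smul_eq_nsmul]
    rw [hc'] at h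
    have hci := eq_zero_of_sum_smul_root_mem_span b (sdiff_singleton_subset_support b i) h hi fun h' ↦ h'.2 rfl
    have hci' : c i = 0 := by exact_mod_cast hci
    rw [hc]
    refine AddSubmonoid.sum_mem _ fun j _ ↦ ?_
    by_cases hj : j ∈ (b.support : Set ι) \ {i}
    · exact AddSubmonoid.nsmul_mem _ (AddSubmonoid.subset_closure (Set.mem_image_of_mem P.root hj)) _
    · have hcj : c j = 0 := by
        by_cases hjs : j ∈ b.support
        · have hji : j = i := by
            by_contra hne
            exact hj ⟨Finset.mem_coe.mpr hjs, hne⟩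
          rw [hji, hci']
        · exact hc0 j hjs
      rw [hcj, zero_smul]
      exact zero_mem _
  · refine (AddSubmonoid.closure_le.mpr ?_) h
    exact fun x hx ↦ Submodule.subset_span hx

omit [P.IsCrystallographic] [P.IsReduced] in
/-- ★★★ **PROPOSITION 2.14 (b), ROOT FORM: IF THE `β`-HEIGHT OF THE HIGHEST ROOT IS `1`, EVERY ROOT HAS `β`-HEIGHT `1`, `0` OR `-1`** — the
partition `Δ = Δ₁ ∪ Δ₀ ∪ Δ₋₁`: for `θ` the highest root, `i ∈ Δ` with `θ - α_i ∈ span(Π₀)`, and any root `α_k`: `α_k - α_i ∈ span(Π₀)` or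
`α_k ∈ span(Π₀)` or `α_k + α_i ∈ span(Π₀)` (the coefficients of `±α_k` are bounded by those of `θ`).
[cite: Tevelev2001, §3 Prop. 2.14 (b) and "Δ = Δ₋₁ ∪ Δ₀ ∪ Δ₁ is the partition corresponding to the short grading"] -/
theorem root_sub_mem_or_mem_or_add_mem_of_highestRoot {θ : ι}
    (hθ : ∀ k, P.root θ - P.root k ∈ AddSubmonoid.closure (P.root '' (b.support : Set ι))) {i : ι} (hi : i ∈ b.support)
    (hθi : P.root θ - P.root i ∈ span K (P.root '' ((b.support : Set ι) \ {i}))) (k : ι) :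
    P.root k - P.root i ∈ span K (P.root '' ((b.support : Set ι) \ {i})) ∨ P.root k ∈ span K (P.root '' ((b.support : Set ι) \ {i})) ∨
      P.root k + P.root i ∈ span K (P.root '' ((b.support : Set ι) \ {i})) := by
  letI := P.indexNeg
  obtain ⟨f, -, -, hf⟩ := b.exists_root_eq_sum_int θ
  obtain ⟨g, -, -, hg⟩ := b.exists_root_eq_sum_int k
  have hfi : f i = 1 := (root_sub_root_mem_span_sdiff_iff b hi hf).mp hθi
  have h1 : g i ≤ 1 := hfi ▸ intCoeff_le_of_highestRoot b hθ hf hg hi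
  -- the coefficients of `-α_k` are `-g`
  have hng : P.root (-k) = ∑ j ∈ b.support, (-g) j • P.root j := by
    have e : P.root (-k) = -P.root k := by
      change P.root (P.reflectionPerm k k) = _
      rw [RootPairing.root_reflectionPerm, RootPairing.reflection_apply_self]
    rw [e, hg, ← Finset.sum_neg_distrib]
    exact Finset.sum_congr rfl fun j _ ↦ by rw [Pi.neg_apply, neg_smul]
  have h2 : (-g) i ≤ 1 := hfi ▸ intCoeff_le_of_highestRoot b hθ hf hng hi
  rw [Pi.neg_apply] at h2
  rcases (show g i = 1 ∨ g i = 0 ∨ g i = -1 by omega) with h | h | h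
  · exact Or.inl ((root_sub_root_mem_span_sdiff_iff b hi hg).mpr h)
  · exact Or.inr (Or.inl ((root_mem_span_sdiff_iff b hi hg).mpr h))
  · exact Or.inr (Or.inr ((root_add_root_mem_span_sdiff_iff b hi hg).mpr h))

omit [CharZero K] [Fintype ι] [P.IsCrystallographic] [P.IsReduced] in
/-- `Δ₁ ∩ Δ₀ = ∅`: `α_k - α_i ∈ span(Π₀)` ⟹ `α_k ∉ span(Π₀)`. [cite: Tevelev2001, §3 ("the partition corresponding to the short grading")] -/
theorem root_notMem_span_sdiff_of_root_sub_root_mem {i : ι} (hi : i ∈ b.support) {k : ι}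
    (hk : P.root k - P.root i ∈ span K (P.root '' ((b.support : Set ι) \ {i}))) : P.root k ∉ span K (P.root '' ((b.support : Set ι) \ {i})) := by
  refine root_notMem_span_of_root_sub_root_mem_span (root_notMem_span_sdiff b hi) (l := k) ?_
  rw [← neg_sub]
  exact neg_mem hk

omit [Fintype ι] [P.IsCrystallographic] [P.IsReduced] in
/-- `Δ₁ ∩ Δ₋₁ = ∅`: `α_k - α_i ∈ span(Π₀)` ⟹ `α_k + α_i ∉ span(Π₀)` (else `2α_i ∈ span(Π₀)`). [cite: Tevelev2001, §3 ("the partition corresponding to the short grading")] -/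
theorem root_add_root_notMem_span_sdiff_of_root_sub_root_mem {i : ι} (hi : i ∈ b.support) {k : ι}
    (hk : P.root k - P.root i ∈ span K (P.root '' ((b.support : Set ι) \ {i}))) : P.root k + P.root i ∉ span K (P.root '' ((b.support : Set ι) \ {i})) := by
  intro h
  apply root_notMem_span_sdiff b hi
  have h2 : (2 : K) • P.root i = (P.root k + P.root i) - (P.root k - P.root i) := by rw [two_smul]; abel
  have h3 : (2 : K) • P.root i ∈ span K (P.root '' ((b.support : Set ι) \ {i})) := by
    rw [h2]
    exact sub_mem h hk
  have h4 := Submodule.smul_mem _ ((2 : K)⁻¹) h3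
  rwa [smul_smul, inv_mul_cancel₀ two_ne_zero, one_smul] at h4

omit [CharZero K] [Fintype ι] [P.IsCrystallographic] [P.IsReduced] in
/-- `Δ₋₁ ∩ Δ₀ = ∅`: `α_k + α_i ∈ span(Π₀)` ⟹ `α_k ∉ span(Π₀)`. [cite: Tevelev2001, §3 ("the partition corresponding to the short grading")] -/
theorem root_notMem_span_sdiff_of_root_add_root_mem {i : ι} (hi : i ∈ b.support) {k : ι}
    (hk : P.root k + P.root i ∈ span K (P.root '' ((b.support : Set ι) \ {i}))) : P.root k ∉ span K (P.root '' ((b.support : Set ι) \ {i})) :=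
  fun h ↦ root_notMem_span_sdiff b hi (by simpa using sub_mem hk h)

omit [Fintype ι] [P.IsCrystallographic] [P.IsReduced] in
/-- ★ **`Δ₁ ⊆ Δ⁺`**: a root of `β`-height `1` is positive. [cite: Tevelev2001, §3 ("Δ⁺ = Δ₀⁺ ∪ Δ₁")] -/
theorem isPos_of_root_sub_root_mem_span_sdiff {i : ι} (hi : i ∈ b.support) {k : ι}
    (hk : P.root k - P.root i ∈ span K (P.root '' ((b.support : Set ι) \ {i}))) : b.IsPos k := by
  refine isPos_of_root_sub_root_mem_span b (sdiff_singleton_subset_support b i) (b.isPos_of_mem_support hi) (root_notMem_span_sdiff b hi) ?_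
  rw [← neg_sub]
  exact neg_mem hk

omit [Fintype ι] [P.IsCrystallographic] [P.IsReduced] in
/-- ★ **`Δ₋₁ ⊆ Δ⁻`**: a root of `β`-height `-1` is negative. [cite: Tevelev2001, §3 ("Δ⁺ = Δ₀⁺ ∪ Δ₁")] -/
theorem not_isPos_of_root_add_root_mem_span_sdiff {i : ι} (hi : i ∈ b.support) {k : ι}
    (hk : P.root k + P.root i ∈ span K (P.root '' ((b.support : Set ι) \ {i}))) : ¬ b.IsPos k := by
  letI := P.indexNeg
  have e : P.root (-k) = -P.root k := by
    change P.root (P.reflectionPerm k k) = _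
    rw [RootPairing.root_reflectionPerm, RootPairing.reflection_apply_self]
  have h1 : P.root (-k) - P.root i ∈ span K (P.root '' ((b.support : Set ι) \ {i})) := by
    rw [e, ← neg_add', neg_mem_iff]
    exact hk
  exact (RootPairing.Base.IsPos.neg_iff_not b k).mp (isPos_of_root_sub_root_mem_span_sdiff b hi h1)

omit [P.IsCrystallographic] [P.IsReduced] in
/-- ★★ **«`Δ⁺ = Δ₀⁺ ∪ Δ₁`»: WHEN THE `β`-HEIGHT OF `θ` IS `1`, A POSITIVE ROOT OUTSIDE `Δ₀` LIES IN `Δ₁`** (the unipotent radical of the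
maximal parabolic `P_β` is `𝔩₁`). [cite: Tevelev2001, §3 ("Here 𝔩₀ ⊕ 𝔩₁ = 𝔭 and exp(𝔩₁) is the abelian unipotent radical of P"; "Δ⁺ = Δ₀⁺ ∪ Δ₁")] -/
theorem root_sub_root_mem_span_sdiff_of_isPos_of_notMem {θ : ι}
    (hθ : ∀ k, P.root θ - P.root k ∈ AddSubmonoid.closure (P.root '' (b.support : Set ι))) {i : ι} (hi : i ∈ b.support)
    (hθi : P.root θ - P.root i ∈ span K (P.root '' ((b.support : Set ι) \ {i}))) {k : ι} (hk : b.IsPos k)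
    (hkV : P.root k ∉ span K (P.root '' ((b.support : Set ι) \ {i}))) :
    P.root k - P.root i ∈ span K (P.root '' ((b.support : Set ι) \ {i})) := by
  rcases root_sub_mem_or_mem_or_add_mem_of_highestRoot b hθ hi hθi k with h | h | h
  · exact h
  · exact absurd h hkV
  · exact absurd hk (not_isPos_of_root_add_root_mem_span_sdiff b hi h)

omit [CharZero K] [Fintype ι] [P.IsCrystallographic] [P.IsReduced] in
/-- ★ **«THERE IS A UNIQUE SIMPLE ROOT IN `Δ₁`»**: a simple root of `β`-height `1` is `β`. [cite: Tevelev2001, §3 ("Thus, there is a unique simple root in Δ₁. Call it β")] -/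
theorem eq_of_mem_support_of_root_sub_root_mem_span_sdiff {i : ι} (hi : i ∈ b.support) {j : ι} (hj : j ∈ b.support)
    (h : P.root j - P.root i ∈ span K (P.root '' ((b.support : Set ι) \ {i}))) : j = i := by
  by_contra hne
  have hjV : P.root j ∈ span K (P.root '' ((b.support : Set ι) \ {i})) :=
    root_mem_span_of_mem ⟨Finset.mem_coe.mpr hj, hne⟩
  exact root_notMem_span_sdiff_of_root_sub_root_mem b hi h hjV

omit [Fintype ι] [P.IsCrystallographic] [P.IsReduced] in
/-- ★ **`β` IS A LOWEST ROOT OF `Δ₁`**: `ht β = 1 ≤ ht α` for every `α ∈ Δ₁`. [cite: Tevelev2001, §3 proof of Prop. 2.14 (a) ("β is the unique lowest weight of the 𝔤-module 𝔩₁")] -/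
theorem height_le_of_root_sub_root_mem_span_sdiff {i : ι} (hi : i ∈ b.support) {k : ι}
    (hk : P.root k - P.root i ∈ span K (P.root '' ((b.support : Set ι) \ {i}))) : b.height i ≤ b.height k := by
  rw [b.height_one_of_mem_support hi]
  have := (RootPairing.Base.isPos_iff b).mp (isPos_of_root_sub_root_mem_span_sdiff b hi hk)
  omega

omit [P.IsReduced] in
/-- ★★ **`β` IS THE UNIQUE LOWEST ROOT OF `Δ₁`**: a root `α_k ∈ Δ₁` with `ht α_k ≤ ht β` is `β` (Malle–Testerman A.31 (b), g40-#1, for the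
shape class `Δ₁`). [cite: Tevelev2001, §3 proof of Prop. 2.14 (a) ("β is the unique lowest weight")] [cite: MalleTesterman2011, App. A Lemma A.31 (b)] -/
theorem eq_of_root_sub_root_mem_span_sdiff_of_height_le {i : ι} (hi : i ∈ b.support) {k : ι}
    (hk : P.root k - P.root i ∈ span K (P.root '' ((b.support : Set ι) \ {i}))) (hle : b.height k ≤ b.height i) : k = i := by
  have hk' : P.root i - P.root k ∈ span K (P.root '' ((b.support : Set ι) \ {i})) := by
    rw [← neg_sub]
    exact neg_mem hk
  refine (eq_of_forall_height_le_of_forall_height_le b (sdiff_singleton_subset_support b i) (root_notMem_span_sdiff b hi) hk'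
    (fun m hm ↦ ?_) (fun m hm ↦ ?_)).symm
  · refine height_le_of_root_sub_root_mem_span_sdiff b hi ?_
    rw [← neg_sub]
    exact neg_mem hm
  · refine hle.trans (height_le_of_root_sub_root_mem_span_sdiff b hi ?_)
    have e : P.root m - P.root i = (P.root k - P.root i) - (P.root k - P.root m) := by abel
    rw [e]
    exact sub_mem hk hm

end Levels

/-! ## §2 «Abelian unipotent radical» ⟺ the `β`-height of the highest root is `1` -/

section Abelian

omit [P.IsCrystallographic] [P.IsReduced] in
/-- ★★★ **`Δ₁ + Δ₁` CONTAINS NO ROOT («`[e_α, e_{α'}] = 0`»)**: if the `β`-height of `θ` is `1` and `α_k, α_l ∈ Δ₁`, then `α_k + α_l` is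
not a root (its `β`-height would be `2 > 1`). [cite: Tevelev2001, §3 proof of Prop. 2.14 (c) ("Since [e_α, e_{α'}] = 0, it follows that α + α' is not a root") and "On the contrary … clearly, the maximal parabolic subgroup corresponding to β has an abelian unipotent radical"] -/
theorem root_add_root_notMem_range_of_highestRoot {θ : ι}
    (hθ : ∀ k, P.root θ - P.root k ∈ AddSubmonoid.closure (P.root '' (b.support : Set ι))) {i : ι} (hi : i ∈ b.support)
    (hθi : P.root θ - P.root i ∈ span K (P.root '' ((b.support : Set ι) \ {i}))) {k l : ι}
    (hk : P.root k - P.root i ∈ span K (P.root '' ((b.support : Set ι) \ {i})))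
    (hl : P.root l - P.root i ∈ span K (P.root '' ((b.support : Set ι) \ {i}))) : P.root k + P.root l ∉ Set.range P.root := by
  rintro ⟨m, hm⟩
  obtain ⟨f, -, -, hf⟩ := b.exists_root_eq_sum_int θ
  obtain ⟨gk, -, -, hgk⟩ := b.exists_root_eq_sum_int k
  obtain ⟨gl, -, -, hgl⟩ := b.exists_root_eq_sum_int l
  have hm' : P.root m = ∑ j ∈ b.support, (gk j + gl j) • P.root j := by
    rw [hm, hgk, hgl, ← Finset.sum_add_distrib]
    exact Finset.sum_congr rfl fun j _ ↦ (add_smul _ _ _).symm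
  have h1 := intCoeff_le_of_highestRoot b hθ hf hm' hi
  have hfi : f i = 1 := (root_sub_root_mem_span_sdiff_iff b hi hf).mp hθi
  have hki : gk i = 1 := (root_sub_root_mem_span_sdiff_iff b hi hgk).mp hk
  have hli : gl i = 1 := (root_sub_root_mem_span_sdiff_iff b hi hgl).mp hl
  simp only [hfi, hki, hli] at h1
  omega

omit [P.IsCrystallographic] [P.IsReduced] in
/-- ★★ **THE RADICAL IS ABELIAN**: if the `β`-height of `θ` is `1`, the sum of two POSITIVE roots outside `Δ₀` is never a root.
[cite: Tevelev2001, §3 ("On the contrary, if … the β-height of the highest root is equal to 1, then, clearly, the maximal parabolic subgroup corresponding to β has an abelian unipotent radical")] [cite: RichardsonRoehrleSteinberg1992, Lemma 2.3] -/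
theorem root_add_root_notMem_range_of_isPos_of_notMem {θ : ι}
    (hθ : ∀ k, P.root θ - P.root k ∈ AddSubmonoid.closure (P.root '' (b.support : Set ι))) {i : ι} (hi : i ∈ b.support)
    (hθi : P.root θ - P.root i ∈ span K (P.root '' ((b.support : Set ι) \ {i}))) {k l : ι}
    (hk : b.IsPos k) (hkV : P.root k ∉ span K (P.root '' ((b.support : Set ι) \ {i})))
    (hl : b.IsPos l) (hlV : P.root l ∉ span K (P.root '' ((b.support : Set ι) \ {i}))) : P.root k + P.root l ∉ Set.range P.root :=
  root_add_root_notMem_range_of_highestRoot b hθ hi hθi (root_sub_root_mem_span_sdiff_of_isPos_of_notMem b hθ hi hθi hk hkV)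
    (root_sub_root_mem_span_sdiff_of_isPos_of_notMem b hθ hi hθi hl hlV)

/-- ★★★ **CONVERSELY: IF NO TWO POSITIVE ROOTS OUTSIDE `Δ₀ = Φ ∩ span(Π₀)` ADD UP TO A ROOT, THE `β`-HEIGHT OF `θ` IS `1`** (`Φ` irreducible,
`θ` its highest root, `β = α_i` simple). Root-level proof: positive roots arise from simple ones by adding simple roots (Mathlib
`IsPos.induction_on_add`); along the way the `α_i`-coefficient can only pass from `1` to `2` by adding `α_i` to a positive root of
`β`-height `1` — a forbidden sum; so every positive root, in particular `θ`, has `β`-height `≤ 1`, and `θ` has all coefficients `≥ 1`.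
[cite: RichardsonRoehrleSteinberg1992, Lemma 2.3 ("P_J has an abelian unipotent radical if and only if P_J is maximal and the corresponding simple root occurs in the highest root with coefficient 1")] [cite: Tevelev2001, §3 Prop. 2.14 (b)] -/
theorem root_sub_root_mem_span_sdiff_of_forall_add_notMem [Nonempty ι] [P.IsIrreducible] {θ : ι}
    (hθ : ∀ k, P.root θ - P.root k ∈ AddSubmonoid.closure (P.root '' (b.support : Set ι))) {i : ι} (hi : i ∈ b.support)
    (hab : ∀ k l, b.IsPos k → P.root k ∉ span K (P.root '' ((b.support : Set ι) \ {i})) →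
      b.IsPos l → P.root l ∉ span K (P.root '' ((b.support : Set ι) \ {i})) → P.root k + P.root l ∉ Set.range P.root) :
    P.root θ - P.root i ∈ span K (P.root '' ((b.support : Set ι) \ {i})) := by
  classical
  -- every positive root has `α_i`-coefficient `≤ 1`
  have key : ∀ k, b.IsPos k → ∀ g : ι → ℤ, P.root k = ∑ j ∈ b.support, g j • P.root j → g i ≤ 1 := by
    intro k hk
    refine hk.induction_on_add (p := fun k ↦ ∀ g : ι → ℤ, P.root k = ∑ j ∈ b.support, g j • P.root j → g i ≤ 1) ?_ ?_
    · intro m hm g hg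
      have h1 : g i = (Pi.single m (1 : ℤ) : ι → ℤ) i := coeff_unique b (hg.symm.trans (root_eq_sum_single b hm)) hi
      rw [h1, Pi.single_apply]
      split_ifs <;> omega
    · intro k' j m hm ih hj g hg
      obtain ⟨g', -, -, hg'⟩ := b.exists_root_eq_sum_int k'
      have h1 := ih g' hg'
      have hm' : P.root m = ∑ l ∈ b.support, (g' l + (Pi.single j (1 : ℤ) : ι → ℤ) l) • P.root l := by
        rw [hm, hg', root_eq_sum_single b hj, ← Finset.sum_add_distrib]
        exact Finset.sum_congr rfl fun l _ ↦ (add_smul _ _ _).symm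
      have h2 : g i = g' i + (Pi.single j (1 : ℤ) : ι → ℤ) i := coeff_unique b (hg.symm.trans hm') hi
      by_cases hji : j = i
      · rw [hji, Pi.single_eq_same] at h2
        rw [hji] at hm
        -- if `g' i = 1`, then `α_{k'}` is a positive root outside `Δ₀` and `α_{k'} + α_i = α_m` is a root: forbidden
        by_contra hgt
        have hg'i : g' i = 1 := by omega
        have hk'pos : b.IsPos k' := isPos_of_coeff_pos b hg' hi (by omega)
        have hk'V : P.root k' ∉ span K (P.root '' ((b.support : Set ι) \ {i})) := fun h ↦ by
          have := (root_mem_span_sdiff_iff b hi hg').mp h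
          omega
        exact hab k' i hk'pos hk'V (b.isPos_of_mem_support hi) (root_notMem_span_sdiff b hi) ⟨m, hm⟩
      · rw [Pi.single_eq_of_ne (Ne.symm hji), add_zero] at h2
        omega
  obtain ⟨f, -, -, hf⟩ := b.exists_root_eq_sum_int θ
  have h1 := key θ (isPos_of_highestRoot b hθ) f hf
  have h2 := coeff_pos_of_highestRoot b hθ hf hi
  exact (root_sub_root_mem_span_sdiff_iff b hi hf).mpr (by omega)

/-- ★★★ **RRS LEMMA 2.3 FOR MAXIMAL PARABOLICS, ROOT FORM: the maximal parabolic at the simple root `β` has ABELIAN unipotent radical — no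
two positive roots outside `Δ₀` add up to a root — IFF the `β`-HEIGHT OF THE HIGHEST ROOT IS `1`** (`Φ` irreducible).
[cite: RichardsonRoehrleSteinberg1992, Lemma 2.3] [cite: Tevelev2001, §3 Prop. 2.14 (b)(c) and "On the contrary …"] -/
theorem root_sub_root_mem_span_sdiff_iff_forall_add_notMem [Nonempty ι] [P.IsIrreducible] {θ : ι}
    (hθ : ∀ k, P.root θ - P.root k ∈ AddSubmonoid.closure (P.root '' (b.support : Set ι))) {i : ι} (hi : i ∈ b.support) :
    P.root θ - P.root i ∈ span K (P.root '' ((b.support : Set ι) \ {i})) ↔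
      ∀ k l, b.IsPos k → P.root k ∉ span K (P.root '' ((b.support : Set ι) \ {i})) →
        b.IsPos l → P.root l ∉ span K (P.root '' ((b.support : Set ι) \ {i})) → P.root k + P.root l ∉ Set.range P.root :=
  ⟨fun h _ _ hk hkV hl hlV ↦ root_add_root_notMem_range_of_isPos_of_notMem b hθ hi h hk hkV hl hlV,
    root_sub_root_mem_span_sdiff_of_forall_add_notMem b hθ hi⟩

end Abelian

/-! ## §3 Proposition 2.14 (c): roots of `Δ₁` pair non-negatively -/

section Pairing

omit [P.IsReduced] in
/-- ★★★ **PROPOSITION 2.14 (c): «FOR ANY `α, α' ∈ Δ₁`, `(α, α') ≥ 0`»** — if the `β`-height of `θ` is `1` and `α_k, α_l ∈ Δ₁` then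
`⟨α_k, α_l^∨⟩ ≥ 0` («it follows that `α + α'` is not a root, therefore, `(α, α') ≥ 0`»: Mathlib `root_add_root_mem_of_pairingIn_neg`).
[cite: Tevelev2001, §3 Prop. 2.14 (c) with proof] -/
theorem pairingIn_nonneg_of_root_sub_root_mem_span_sdiff {θ : ι}
    (hθ : ∀ k, P.root θ - P.root k ∈ AddSubmonoid.closure (P.root '' (b.support : Set ι))) {i : ι} (hi : i ∈ b.support)
    (hθi : P.root θ - P.root i ∈ span K (P.root '' ((b.support : Set ι) \ {i}))) {k l : ι}
    (hk : P.root k - P.root i ∈ span K (P.root '' ((b.support : Set ι) \ {i})))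
    (hl : P.root l - P.root i ∈ span K (P.root '' ((b.support : Set ι) \ {i}))) : 0 ≤ P.pairingIn ℤ k l := by
  by_contra h
  push Not at h
  have hkl : P.root k - P.root l ∈ span K (P.root '' ((b.support : Set ι) \ {i})) := by
    have e : P.root k - P.root l = (P.root k - P.root i) - (P.root l - P.root i) := by abel
    rw [e]
    exact sub_mem hk hl
  have hne : P.root k ≠ -P.root l :=
    root_ne_neg_root_of_root_sub_root_mem_span (root_notMem_span_sdiff_of_root_sub_root_mem b hi hk) hkl
  exact root_add_root_notMem_range_of_highestRoot b hθ hi hθi hk hl (P.root_add_root_mem_of_pairingIn_neg h hne)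

end Pairing

/-! ## §4 Proposition 2.14 (d): `W₀`-orbits in `Δ₁` -/

section Orbits

variable (B : P.InvariantForm)

/-- ★★★ **TWO ROOTS OF `Δ₁` OF THE SAME LENGTH ARE `W₀`-CONJUGATE** (`W₀ = W_{Π₀}`; Malle–Testerman's Lemma A.31 (a) for the shape class
`Δ₁`, g40-#1). [cite: Tevelev2001, §3 Prop. 2.14 (d)] [cite: MalleTesterman2011, App. A Lemma A.31 (a)] -/
theorem exists_mem_closure_image_smul_eq_of_root_sub_root_mem_span_sdiff {i : ι} (hi : i ∈ b.support) {k l : ι}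
    (hk : P.root k - P.root i ∈ span K (P.root '' ((b.support : Set ι) \ {i})))
    (hl : P.root l - P.root i ∈ span K (P.root '' ((b.support : Set ι) \ {i})))
    (hlen : B.form (P.root k) (P.root k) = B.form (P.root l) (P.root l)) :
    ∃ w ∈ Subgroup.closure (RootPairing.Equiv.reflection P '' ((b.support : Set ι) \ {i})), w • k = l := by
  refine exists_mem_closure_image_smul_eq_of_form_root_eq b B (sdiff_singleton_subset_support b i)
    (root_notMem_span_sdiff_of_root_sub_root_mem b hi hk) ?_ hlen
  have e : P.root k - P.root l = (P.root k - P.root i) - (P.root l - P.root i) := by abel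
  rw [e]
  exact sub_mem hk hl

/-- ★★★ **PROPOSITION 2.14 (d): «ALL LONG ROOTS IN `Δ₁` ARE `W₀`-CONJUGATE TO `δ`»** — if the `β`-height of the highest root `θ = δ` is `1`,
every root `α_k ∈ Δ₁` of the length of `θ` is `W₀`-conjugate to `θ`. [cite: Tevelev2001, §3 Prop. 2.14 (d) with proof ("Therefore, all long roots in Δ₁ are W₀-conjugate to δ")] -/
theorem exists_mem_closure_image_smul_eq_highestRoot {θ : ι} {i : ι} (hi : i ∈ b.support)
    (hθi : P.root θ - P.root i ∈ span K (P.root '' ((b.support : Set ι) \ {i}))) {k : ι}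
    (hk : P.root k - P.root i ∈ span K (P.root '' ((b.support : Set ι) \ {i})))
    (hlen : B.form (P.root k) (P.root k) = B.form (P.root θ) (P.root θ)) :
    ∃ w ∈ Subgroup.closure (RootPairing.Equiv.reflection P '' ((b.support : Set ι) \ {i})), w • k = θ :=
  exists_mem_closure_image_smul_eq_of_root_sub_root_mem_span_sdiff b B hi hk hθi hlen

end Orbits

/-! ## §5 Proposition 2.14 (a): `β` is long -/

section Long

omit [CharZero K] [P.IsCrystallographic] [P.IsReduced] in
/-- ★★ **COROOT COEFFICIENTS VERSUS ROOT COEFFICIENTS**: if `α_k = Σ_j f_j α_j` and `α_k^∨ = Σ_j c_j α_j^∨` along `Δ`, `Δ^∨`, then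
`c_j · (α_k|α_k) = f_j · (α_j|α_j)` for the canonical form `( | ) = RootForm` — from `(α|α)·α^∨ = 2·Polarization(α)` (Mathlib
`rootForm_self_smul_coroot`) and linearity of the polarization. [cite: MalleTesterman2011, App. A Exercise A.4 (a) ("the map α ↦ pα^∨ (α long), α^∨ (α short) extends to a homothety")] [cite: Tevelev2001, §3 Prop. 2.14 (a)] -/
theorem intCast_corootCoeff_mul_rootForm_eq {k : ι} {f : ι → ℤ} (hf : P.root k = ∑ j ∈ b.support, f j • P.root j)
    {c : ι → ℤ} (hc : P.coroot k = ∑ j ∈ b.support, c j • P.coroot j) {j : ι} (hj : j ∈ b.support) :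
    (c j : K) * P.RootForm (P.root k) (P.root k) = (f j : K) * P.RootForm (P.root j) (P.root j) := by
  -- `(α_k|α_k) • α_k^∨ = Σ_j (f_j (α_j|α_j)) • α_j^∨`
  have h1 : P.RootForm (P.root k) (P.root k) • P.coroot k =
      ∑ j ∈ b.support, ((f j : K) * P.RootForm (P.root j) (P.root j)) • P.coroot j := by
    rw [P.rootForm_self_smul_coroot k, hf, map_sum, Finset.smul_sum]
    refine Finset.sum_congr rfl fun j _ ↦ ?_
    rw [map_zsmul, smul_comm, ← P.rootForm_self_smul_coroot j, ← Int.cast_smul_eq_zsmul K, smul_smul]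
  -- `(α_k|α_k) • α_k^∨ = Σ_j ((α_k|α_k) c_j) • α_j^∨`
  have h2 : P.RootForm (P.root k) (P.root k) • P.coroot k =
      ∑ j ∈ b.support, (P.RootForm (P.root k) (P.root k) * (c j : K)) • P.coroot j := by
    rw [hc, Finset.smul_sum]
    refine Finset.sum_congr rfl fun j _ ↦ ?_
    rw [← Int.cast_smul_eq_zsmul K, smul_smul]
  have h3 : ∑ j ∈ b.flip.support, (P.RootForm (P.root k) (P.root k) * (c j : K)) • P.flip.root j =
      ∑ j ∈ b.flip.support, ((f j : K) * P.RootForm (P.root j) (P.root j)) • P.flip.root j := by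
    simpa only [RootPairing.flip_root, RootPairing.Base.flip_support] using h2.symm.trans h1
  have h4 := eq_of_sum_smul_root_eq b.flip h3 (by simpa only [RootPairing.Base.flip_support] using hj)
  rw [← h4, mul_comm]

/-- ★★★ **PROPOSITION 2.14 (a): «`β` IS LONG»** — `Φ` irreducible with highest root `θ`, `β = α_i` a simple root with `θ - α_i ∈ span(Π₀)`
(`β`-height of `θ` equal to `1`): `(β|β) = (θ|θ)` for the canonical form. Root-level proof: `c_i (θ|θ) = 1 · (β|β)` for the integer
coefficient `c_i` of `β^∨` in `θ^∨`, while `(θ|θ) ∈ {1, 2, 3} · (β|β)` (the highest root is long, tree `form_highestRoot_eq_or`); `c_i d = 1`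
forces `d = 1`. [cite: Tevelev2001, §3 Prop. 2.14 (a)] -/
theorem rootForm_root_eq_rootForm_highestRoot_of_root_sub_root_mem_span_sdiff [Nonempty ι] [P.IsIrreducible] {θ : ι}
    (hθ : ∀ k, P.root θ - P.root k ∈ AddSubmonoid.closure (P.root '' (b.support : Set ι))) {i : ι} (hi : i ∈ b.support)
    (hθi : P.root θ - P.root i ∈ span K (P.root '' ((b.support : Set ι) \ {i}))) :
    P.RootForm (P.root i) (P.root i) = P.RootForm (P.root θ) (P.root θ) := by
  obtain ⟨f, -, -, hf⟩ := b.exists_root_eq_sum_int θ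
  obtain ⟨c, -, -, hc⟩ := b.flip.exists_root_eq_sum_int θ
  have hc' : P.coroot θ = ∑ j ∈ b.support, c j • P.coroot j := by
    simpa only [RootPairing.flip_root, RootPairing.Base.flip_support] using hc
  have hfi : f i = 1 := (root_sub_root_mem_span_sdiff_iff b hi hf).mp hθi
  have h1 := intCast_corootCoeff_mul_rootForm_eq b hf hc' hi
  rw [hfi, Int.cast_one, one_mul] at h1
  have hne : P.RootForm (P.root i) (P.root i) ≠ 0 := by
    simpa only [RootPairing.toInvariantForm_form] using P.toInvariantForm.ne_zero i
  rcases form_highestRoot_eq_or b P.toInvariantForm hθ i with h | h | h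
  · simp only [RootPairing.toInvariantForm_form] at h
    exact h.symm
  · exfalso
    simp only [RootPairing.toInvariantForm_form] at h
    rw [h] at h1
    have h2 : ((2 * c i - 1 : ℤ) : K) * P.RootForm (P.root i) (P.root i) = 0 := by
      push_cast
      linear_combination h1
    have h3 : ((2 * c i - 1 : ℤ) : K) = 0 := (mul_eq_zero.mp h2).resolve_right hne
    have h4 : (2 * c i - 1 : ℤ) = 0 := by exact_mod_cast h3
    omega
  · exfalso
    simp only [RootPairing.toInvariantForm_form] at h
    rw [h] at h1
    have h2 : ((3 * c i - 1 : ℤ) : K) * P.RootForm (P.root i) (P.root i) = 0 := by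
      push_cast
      linear_combination h1
    have h3 : ((3 * c i - 1 : ℤ) : K) = 0 := (mul_eq_zero.mp h2).resolve_right hne
    have h4 : (3 * c i - 1 : ℤ) = 0 := by exact_mod_cast h3
    omega

/-- ★★★ **PROPOSITION 2.14 (a) FOR ANY INVARIANT FORM `B`: `B(β, β) = B(θ, θ)`** (`β` and `θ` are `W`-conjugate). [cite: Tevelev2001, §3 Prop. 2.14 (a) ("β is long")] -/
theorem form_root_eq_form_highestRoot_of_root_sub_root_mem_span_sdiff [Nonempty ι] [P.IsIrreducible] (B : P.InvariantForm) {θ : ι}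
    (hθ : ∀ k, P.root θ - P.root k ∈ AddSubmonoid.closure (P.root '' (b.support : Set ι))) {i : ι} (hi : i ∈ b.support)
    (hθi : P.root θ - P.root i ∈ span K (P.root '' ((b.support : Set ι) \ {i}))) :
    B.form (P.root i) (P.root i) = B.form (P.root θ) (P.root θ) := by
  have h := rootForm_root_eq_rootForm_highestRoot_of_root_sub_root_mem_span_sdiff b hθ hi hθi
  obtain ⟨w, hw, hwi⟩ := exists_weylGroup_smul_eq_of_form_root_eq P.toInvariantForm (i := i) (j := θ)
    (by simpa only [RootPairing.toInvariantForm_form] using h)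
  rw [← hwi, form_root_smul_root_smul B hw i i]

end Long

/-! ## §6 Proposition 2.15 (a): a root of `Δ₁` orthogonal to `β` forces `θ ⊥ β` -/

section Orthogonal

/-- ★★★ **PROPOSITION 2.15 (a): IF SOME `α₀ ∈ Δ₁` IS ORTHOGONAL TO `β`, THEN SO IS THE HIGHEST ROOT** (`δ ∈ Δ'₁`): with `θ - α₀ = Σ_{α ∈ Π₀} n_α α`,
`n_α ≥ 0`, «`(β, δ) = (β, α₀) + (β, Σ n_α α)` … `≤ 0`» since `⟨α, β^∨⟩ ≤ 0` on `Π₀`, and `⟨θ, β^∨⟩ ≥ 0`. Here `⟨α_k, β^∨⟩ = 0` ⟹ `⟨θ, β^∨⟩ = 0`.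
[cite: Tevelev2001, §3 Prop. 2.15 (a) with proof] -/
theorem pairingIn_highestRoot_eq_zero_of_pairingIn_eq_zero [Nonempty ι] {θ : ι}
    (hθ : ∀ k, P.root θ - P.root k ∈ AddSubmonoid.closure (P.root '' (b.support : Set ι))) {i : ι} (hi : i ∈ b.support)
    (hθi : P.root θ - P.root i ∈ span K (P.root '' ((b.support : Set ι) \ {i}))) {k : ι}
    (hk : P.root k - P.root i ∈ span K (P.root '' ((b.support : Set ι) \ {i}))) (h0 : P.pairingIn ℤ k i = 0) :
    P.pairingIn ℤ θ i = 0 := by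
  obtain ⟨f, -, -, hf⟩ := b.exists_root_eq_sum_int θ
  obtain ⟨g, -, -, hg⟩ := b.exists_root_eq_sum_int k
  have hfi : f i = 1 := (root_sub_root_mem_span_sdiff_iff b hi hf).mp hθi
  have hgi : g i = 1 := (root_sub_root_mem_span_sdiff_iff b hi hg).mp hk
  -- `⟨θ, β^∨⟩ - ⟨α_k, β^∨⟩ = Σ_j (f_j - g_j) ⟨α_j, β^∨⟩ ≤ 0`
  have e1 := pairingIn_eq_sum_of_root_eq_sum hf i
  have e2 := pairingIn_eq_sum_of_root_eq_sum hg i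
  have hle : P.pairingIn ℤ θ i - P.pairingIn ℤ k i ≤ 0 := by
    rw [e1, e2, ← Finset.sum_sub_distrib]
    refine Finset.sum_nonpos fun j hj ↦ ?_
    rw [← sub_mul]
    by_cases hji : j = i
    · rw [hji, hfi, hgi, sub_self, zero_mul]
    · exact mul_nonpos_iff.mpr (Or.inl ⟨sub_nonneg.mpr (intCoeff_le_of_highestRoot b hθ hf hg hj),
        b.pairingIn_le_zero_of_ne hji hj hi⟩)
  have hge := pairingIn_nonneg_of_highestRoot b hθ hi
  omega

end Orthogonal

end Base

end Literature.LinearAlgebra.RootSystem
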